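import Summits.BirchSwinnertonDyer.BirchSwinnertonDyer.Theses.AlignedTransportAtTwo
import Summits.BirchSwinnertonDyer.BirchSwinnertonDyer.Theorems.AlignedTransportAtTwoBSDOfMainConjectureRankOneAtTwoOrderTransfer
import Summits.BirchSwinnertonDyer.BirchSwinnertonDyer.Theorems.AlignedTransportAtTwoBSDOfMainConjectureRankOneAtTwoEulerCharAtTwoCell
import HarnessLib

/-! # Line `birth` — v6 PROPOSAL (attach seat `bsd-line-att-p4` g6 for the C3′ lead lineage `bsd-line-att-p1`; NOT registered — the lead's call)
crux `Summit.BirchSwinnertonDyer.BirchSwinnertonDyer.Theses.AlignedTransportAtTwo.BSDOfMainConjectureRankOneAtTwo` (stmt-BirchSwinnertonDyer-23008).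

**v6 = v5 with the ONE open stub RE-POINTED LOSSLESSLY at the `Γ`-Euler-characteristic (descent) statement at `2` and nothing else changed.**
v5's `stub_leadingTermFormulaAtTwo : F1Sign2.SchneiderLeadingTermFormulaAtTwoSq` (Schneider / BMS 1.7 (3) leading-term FORMULA at `2`) is, by the
kernel theorem `…Theorems.AlignedTransportAtTwoEulerCharAtTwo.schneiderLeadingTermFormulaAtTwoSq_iff_eulerChar` (p624996), EQUIVALENT to the statement
registered below as `stub_eulerCharAtTwo`: for `W` good ordinary at `2`, every cyclotomic datum, every finitely generated torsion strict-at-`∞` dual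
`X = D.X`, THE `Σ²` height `Dh`, given `Reg₂(Dh) ≠ 0` and `Ш(E/ℚ)(2)` finite — `ker φ_X` is finite and
`#coker φ_X·(log₂ 5)^r·#E(ℚ)(2)² = u·#ker φ_X·Reg₂(Dh)·#Ш(2)·2^{v₂(∏c_v)}·#Ẽ(𝔽₂)(2)²` (`φ_X = bockstein 2 X : X[T] → X/TX`; Coates–Schneider–Sujatha
2003 p. 204 «Case 2», printed for `p ⩾ 5`, READ AT `p = 2` on the Pontryagin-dual side: `χ(Γ, Sel_{2^∞}(E/ℚ_∞)) = #coker φ_X/#ker φ_X`).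
WHY RE-POINT: Mazur's control theorem at `2` (tree theorem), clause 1 `rank ≤ ord f_E`, the passage «`χ(Γ)` ⇝ order and leading coefficient of
`f_E`» and all `2`-adic unit bookkeeping (`#E(ℚ)_tors ∼ #E(ℚ)(2)`, `1 − α⁻¹ ∼ #Ẽ(𝔽₂)(2)`, `∏c_v = 2^v·odd`, `log₂ 5 = 4u`) are now DISCHARGED, so the
crux's single non-PRINT obligation is the descent formula ITSELF — the statement in whose proof the printed `p = 2` obstacles live (LTYZ 2025 §1.2:
finite-submodule control of `X(E/ℚ_∞)` at `2` with the real place; archimedean / even-`c_ℓ` local factors in the Cassels–Poitou–Tate diagram). Moreover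
ON THE CELL `ker φ_X`, `coker φ_X` are already FINITE (`…EulerCharAtTwoCell.finite_bockstein_of_cell`, mod GZK + modularity), so only the VALUE is open,
and per cell curve that value ⟺ `BSDp W 2` (`…EulerCharAtTwoCell.eulerCharValueAt_iff_bsdp`) — TIGHT, exactly as v5 was (p611969).
The statement is carried INLINE (no tree declaration names it yet; -ty is asked to file it as `F1Sign2.EulerCharacteristicFormulaAtTwoSq`, body = this
stub's type verbatim, so a v7 can point at it BY NAME — same move as v4 → v5).
Stub set otherwise = v5 (M `stub_modularityAtTwo`, `stub_gzkAtTwo`, `stub_sigmaSqTwo`, `stub_disegniAtTwo` PRINT + ONE open statement; 5 ≤ stubs_max).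
Composition `BSDOfMainConjectureRankOneAtTwo_of` = `…EulerCharAtTwoCell.bsdOfMainConjectureRankOneAtTwo_of_eulerChar_of_disegni` (p625448), concludes the crux BY NAME.
HONEST FRAMING: BSD is not proved; C3′ stays OPEN modulo exactly ONE statement not in print at `2` and four published facts; every `stub_*` is `sorry`. -/

set_option linter.dupNamespace false

noncomputable section

namespace Summit.BirchSwinnertonDyer.BirchSwinnertonDyer.Cruxes.BSDOfMainConjectureRankOneAtTwo.Birth

open Summit.BirchSwinnertonDyer.BirchSwinnertonDyer.Theses.AlignedTransportAtTwo
open WeierstrassCurve Literature.NumberTheory.EllipticCurves Literature.NumberTheory.EllipticCurves.ModularForms CongruenceSubgroup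
  Literature.NumberTheory.EllipticCurves.Greenberg1999 Literature.NumberTheory.EllipticCurves.IwasawaAlgebra
  Summit.BirchSwinnertonDyer.Rank1Residual.F1Sign2 Summit.BirchSwinnertonDyer.BirchSwinnertonDyer.Theorems.Rank1ResidualX1Defs

/-- stub M — PRINT: modularity in the parametrisation currency (`nonempty_modularParametrizationData`, BCDT 2001 Thm A + Edixhoven). -/
theorem stub_modularityAtTwo : nonempty_modularParametrizationData := by
  sorry

/-- stub L0a — PRINT: Gross–Zagier–Kolyvagin, `r_an ≤ 1 ⇒ rank = r_an ∧ Ш finite` (`rank_eq_analyticRank_of_analyticRank_le_one`).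
[cite: GrossZagier1986] [cite: Kolyvagin1990] -/
theorem stub_gzkAtTwo : rank_eq_analyticRank_of_analyticRank_le_one := by
  sorry

/-- stub L0b — PRINT: the Mazur–Tate sigma-squared division series at `2` (`mazurTate_sigmaSq_existsUnique_two`; Mazur–Tate 1991 Thm 3.1 /
Silverman 2005 §5 Rem 2). [cite: MazurTate1991, Thm. 3.1] -/
theorem stub_sigmaSqTwo : mazurTate_sigmaSq_existsUnique_two := by
  sorry

/-- stub D — PRINT: Disegni 2020 Thm. 1 = Thm. 4 (i) (`Disegni2020.padicBSD_goodOrd_rankOne`, typer p606485). [cite: Disegni2020, Thm. 1] -/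
theorem stub_disegniAtTwo : Disegni2020.padicBSD_goodOrd_rankOne := by
  sorry

/-- stub χ — THE ONE OPEN statement at `2` (v6): the `Γ`-EULER-CHARACTERISTIC (Perrin-Riou–Schneider descent) FORMULA AT `p = 2` over the strict-at-`∞`
dual and the `Σ²` height — for `W/ℚ` globally minimal, good ordinary at `2`, every cyclotomic datum `(κ, γ)`, every finitely generated `Λ`-torsion
`X = D.X`, THE canonical `Dh` (`IsCanonicalSq`): IF `Reg₂(Dh) ≠ 0` and `Ш(E/ℚ)(2)` is finite THEN `ker φ_X` is finite and
`#coker φ_X·(log₂ 5)^{rank E(ℚ)}·#E(ℚ)(2)² = u·#ker φ_X·Reg₂(Dh)·#Ш(2)·2^{v₂(∏c_v)}·#Ẽ(𝔽₂)(2)²`, `u ∈ ℤ₂ˣ`. EQUIVALENT to v5's stub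
(`…EulerCharAtTwo.schneiderLeadingTermFormulaAtTwoSq_iff_eulerChar`); NOT in print at `2` over `ℚ` (CSS 2003 p. 204: `p ⩾ 5`; Perrin-Riou 1992
§3.4.3, Schneider 1985: `p` odd; Delbourgo 2008 §10.1: `p ≥ 3`; Nekovář 2006 ch. 11 only under (P) «no real prime if p = 2»; LTYZ 2025 Prop. 6.2:
CM, totally imaginary base). [cite: CoatesSchneiderSujatha2003, p. 204 (Case 2), §3 (30)–(31) p. 199 (printed for p ⩾ 5; the p = 2 text is ours)]
[cite: PerrinRiou1992, §3.4.3 (p odd)] [cite: Schneider1985, Thm. 2′ (p odd)] -/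
theorem stub_eulerCharAtTwo :
    ∀ (W : WeierstrassCurve ℚ) [W.IsElliptic] [W.IsGloballyMinimal],
      W.HasGoodReductionAtPrime 2 → ¬ (2 : ℤ) ∣ W.frobeniusTrace 2 →
      ∀ (κ : ZpExtension ℚ 2) (γ : Field.absoluteGaloisGroup ℚ),
        κ.IsCyclotomic → κ.IsTopGenerator γ → IsCyclotomicVariable 2 γ →
      ∀ (D : W.SelmerDualData κ γ) [Module.Finite (IwasawaAlgebra 2) D.X], D.IsTorsion →
      ∀ (Dh : PAdicHeightData W 2), Dh.IsCanonicalSq →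
        SchneiderConjecture Dh → Finite (AddCommGroup.primaryComponent W.sha 2) →
        Finite (LinearMap.ker (bockstein 2 D.X)) ∧
        ∃ u : ℤ_[2]ˣ,
          (Nat.card (coinvariants 2 D.X ⧸ LinearMap.range (bockstein 2 D.X)) : ℚ_[2]) *
              padicLog 2 (cyclotomicGenerator 2) ^ W.mordellWeilRank *
              (Nat.card (AddCommGroup.primaryComponent W.toAffine.Point 2) : ℚ_[2]) ^ 2 =
            ((u : ℤ_[2]) : ℚ_[2]) * Nat.card (LinearMap.ker (bockstein 2 D.X)) * padicRegulator Dh *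
              Nat.card (AddCommGroup.primaryComponent W.sha 2) * (2 : ℚ_[2]) ^ (padicValNat 2 W.tamagawaProduct) *
              (Nat.card (AddCommGroup.primaryComponent
                ((integralModelInt W).map (Int.castRingHom (ZMod 2))).toAffine.Point 2) : ℚ_[2]) ^ 2 := by
  sorry

/-- Composition (kernel-checked, closed): the crux BY NAME from the five stubs through p625448 (`…_of_eulerChar_of_disegni`) ∘ p609883 §3. -/
theorem BSDOfMainConjectureRankOneAtTwo_of : BSDOfMainConjectureRankOneAtTwo :=
  Summit.BirchSwinnertonDyer.BirchSwinnertonDyer.Theorems.AlignedTransportAtTwoEulerCharAtTwoCell.bsdOfMainConjectureRankOneAtTwo_of_eulerChar_of_disegni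
    stub_eulerCharAtTwo stub_disegniAtTwo stub_gzkAtTwo stub_modularityAtTwo stub_sigmaSqTwo

/-- v5's stub is RECOVERED from v6's (so nothing registered under v5 is lost): the Schneider leading-term formula at `2` by name. -/
theorem stub_leadingTermFormulaAtTwo_of_v6 : Summit.BirchSwinnertonDyer.Rank1Residual.F1Sign2.SchneiderLeadingTermFormulaAtTwoSq :=
  Summit.BirchSwinnertonDyer.BirchSwinnertonDyer.Theorems.AlignedTransportAtTwoEulerCharAtTwo.schneiderLeadingTermFormulaAtTwoSq_iff_eulerChar.mpr
    stub_eulerCharAtTwo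

end Summit.BirchSwinnertonDyer.BirchSwinnertonDyer.Cruxes.BSDOfMainConjectureRankOneAtTwo.Birth

end
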